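import Summits.BirchSwinnertonDyer.BirchSwinnertonDyer.Theses.UniversalToricDescent
import Summits.BirchSwinnertonDyer.BirchSwinnertonDyer.Theorems.UniversalToricDescentTwinSplitIMCAtThreeOfThreeFrames
import Summits.BirchSwinnertonDyer.BirchSwinnertonDyer.Theorems.UniversalToricDescentSelfMuZeroAtThree
import Summits.BirchSwinnertonDyer.BirchSwinnertonDyer.Theorems.UniversalToricDescentRoadFFDescentOddRational
import Summits.BirchSwinnertonDyer.BirchSwinnertonDyer.Theorems.UniversalToricDescentTwinTorsionRankOne
import Summits.BirchSwinnertonDyer.BirchSwinnertonDyer.Theorems.UniversalToricDescentTwinTorsionRankOneK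
import Summits.BirchSwinnertonDyer.BirchSwinnertonDyer.Theorems.UniversalToricDescentTwinDecLocusCubeTest
import Literature.NumberTheory.EllipticCurves.Skinner2016.HidaCongruentMembers
import Literature.NumberTheory.EllipticCurves.NonEisensteinPrimeOfSurjective
import HarnessLib

/-!
# SKELETON v8 (line `threeframes`, child crux `TwinSplitIMCAtThreeMult` stmt-BirchSwinnertonDyer-20694, bucket B; LEAD bsd-wall-utd-p2 g12,
# 2026-08-28) = v7 (lead g11, 60e458c2989d7ba4) with TWO research stubs CUT DOWN to their residues by landed tree theorems / typed facts

History: v1 (utd-p2 g2 / utd-idea g6) · v3 (lead g4: μ-frame by name) · v4–v5 (lead g11: Wan stub DERIVED from a member tower by the ported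
Road-FF descent p609362/p609906; explicit residual locus) · v6 proposal (w2 g2: `stub_prop323` deleted — tree theorem
`SkinnerUrban2014.prop323_XAc_equiv_XBigDecomp_holds`; Σ-data DERIVED from `stub_torsionMult` via p613967; residual ↦ EXACT cube locus
p612881/p614724) · v7 (lead g11): `stub_memberTowerMult` RATIONAL and m-UNIFORM, consumed by
`twin_exists_wanFrame_of_sigmaData_of_rationalMemberTower` (p616714) with `k = e` · v8 (this file, lead g12):
(a) `stub_torsionMult` ↦ `stub_pubPoitouTate` [PUB: the two Poitou–Tate facts, route binders PT1/PT2] + `stub_torsionMultOffRankOne`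
[R: the same torsion OFF the locus «rank W′(K) = 1 ∧ Ш(W′/K)[3^∞] finite»] + DERIVED `torsionMult_of_stubs` (width seat w2 g3's p617974
`twin_isTorsion_XAc_empty_of_rankOneK_of_poitouTate` ON the locus); (b) `stub_memberTowerMult` ↦ `stub_pubHidaMembers` [PUB: typer utd-ty1
g3's p614192 `skinner2016_exists_hidaCongruentMember_three_le`, Skinner 2016 §3.1 (a)(b) at the printed generality p ≥ 3] +
`stub_memberInclusionMult` [R: frame + ONE exponent `e` + FOR EVERY Hida member `D` at every level `m` the rational one-sided inclusion
(K1) and the `L`-congruence (K2) — the members' EXISTENCE is no longer asserted by the research stub] + DERIVED `memberTowerMult_of_stubs`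
(= v7's registered `stub_memberTowerMult` signature VERBATIM).
Stubs v8 (7 = stubs_max): `stub_howardFrameMult` [R, ⊇, OFF the deciding chain] · `stub_thmB` [PUB] · `stub_pubPoitouTate` [PUB] ·
`stub_torsionMultOffRankOne` [R] · `stub_pubHidaMembers` [PUB] · `stub_memberInclusionMult` [R, the load] · `stub_wanFrameMultCube` [R].
`TwinSplitIMCAtThreeMult_of` concludes the child BY NAME (`twinSplit_instance_of_three_frames`, p543791). v8.1 (lead g12, same stubs):
+ DERIVED `wanFrameMult_of_stubs_of_not_dvd` — the Wan frame for twins with `3 ∤ v₃(Δ_min(W′))` (all très ramifié twins = all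
twins of bucket-B classes, helper p621446) WITHOUT `stub_wanFrameMultCube`: the certificate for re-keying ♭B off the cube locus.
BSD is not proved by any of this; every `sorry` below is a stub.
-/

noncomputable section

open scoped Classical

set_option linter.dupNamespace false
set_option autoImplicit false

namespace Summit.BirchSwinnertonDyer.BirchSwinnertonDyer.Cruxes.TwinSplitIMCAtThreeMult.ThreeFrames

open PowerSeries WeierstrassCurve NumberField IsDedekindDomain Field
  Literature.NumberTheory.EllipticCurves
  Literature.NumberTheory.EllipticCurves.ModularForms
  Literature.NumberTheory.EllipticCurves.Rank1Residual
  Literature.NumberTheory.EllipticCurves.BigGaloisRep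
  Literature.NumberTheory.EllipticCurves.GreenbergSelmer
  Literature.NumberTheory.GaloisRepresentations
  Summit.BirchSwinnertonDyer.Rank1Residual.X11b
  Summit.BirchSwinnertonDyer.Rank1Residual.X11b.Halves
  Summit.BirchSwinnertonDyer.BirchSwinnertonDyer.Theorems.SchneiderFree
  Summit.BirchSwinnertonDyer.BirchSwinnertonDyer.Theorems.UniversalToricDescentTwinSplit
  Summit.BirchSwinnertonDyer.BirchSwinnertonDyer.Theorems.UniversalToricDescentTwinTorsionRankOne
  Summit.BirchSwinnertonDyer.BirchSwinnertonDyer.Theorems.UniversalToricDescentTwinTorsionRankOneK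
  Summit.BirchSwinnertonDyer.BirchSwinnertonDyer.Theorems.UniversalToricDescentTwinDecLocus

/-- STUB (Howard frame at a multiplicative-at-3 twin, 3 ∥ N′: ONE BDP branch inside the Selmer characteristic
ideal — research at p = 3 (Howard 2004: p ∤ N; Castella 2018 §4: p ≥ 5); free at unit pairs (p553371). OFF the deciding
chain after act D (utd pen pss3x g3, 2026-08-28T05:16Z). UNCHANGED from v1/v3. -/
theorem stub_howardFrameMult :
    ∀ (W' : WeierstrassCurve ℚ) [W'.IsElliptic] [W'.IsGloballyMinimal] (N' : ℕ) [NeZero N']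
      (K : Type) [Field K] [NumberField K] (Dt' : ModularParametrizationData W' N'),
      Mult W' 3 → W'.HasSurjectiveModNGaloisRep 3 → W'.conductorNorm ℤ = N' → IsImaginaryQuadratic K →
      SatisfiesHeegnerHypothesis N' K → Odd (NumberField.discr K) →
      ∀ (κ : ZpExtension K 3), κ.IsAnticyclotomic → ∀ (γ : absoluteGaloisGroup K) [Fact (κ.IsTopGenerator γ)]
        (𝔭 : HeightOneSpectrum (𝓞 K)), ((3 : ℕ) : 𝓞 K) ∈ 𝔭.asIdeal →
        𝔭.asIdeal.ramificationIdx (𝓞 ℚ) = 1 → 𝔭.asIdeal.inertiaDeg (𝓞 ℚ) = 1 →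
        ∀ (𝔭' : HeightOneSpectrum (𝓞 K)), ((3 : ℕ) : 𝓞 K) ∈ 𝔭'.asIdeal → 𝔭' ≠ 𝔭 →
        ∀ (ι' : PadicAlgCl 3 ≃+* ℂ), BranchInducesPrime 3 ι' 𝔭 →
        ∃ (ΩK : ℂ) (Ωp : ℂ_[3]) (L : UnrSeries 3), ΩK ≠ 0 ∧ Ωp ≠ 0 ∧
          IsBDPLFunction ι' 𝔭 κ γ Dt'.f ΩK Ωp L ∧
          L ∈ (AcSelmer.XAc.charIdeal (W'.baseChange K) 3 κ 𝔭' ∅ γ).map (PowerSeries.map (toUnr 3)) := by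
  sorry

/-- STUB (BY-NAME, refereed; closes only by formalisation): Hsieh 2014 Thm. B at every level — for a weight-2 newform
`f`, `p` odd split in `K`, classical Heegner hypothesis, absolutely irreducible residual representation over `K`: an
anticyclotomic `p`-adic `L`-function `Q ∈ 𝓞_{ℂ_p}⟦T⟧` with unramified `p`-adic period and a coefficient of norm one
(`μ = 0`). UNCHANGED from v3. [cite: Hsieh2014, Thm. B p. 712 (Doc. Math. 19)] -/
theorem stub_thmB : Hsieh2014.thmB_exists_isHsiehLFunction_coeff_norm_eq_one_unrPeriod_anyLevel := by
  sorry

/-- STUB (BY-NAME, PUBLISHED — closes only by formalisation; v8): the two Poitou–Tate facts for every number field — (PT1)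
the Greenberg–Wiles / Selmer-structure duality `poitouTate_selmerStructure_duality` and (PT2) the `Ш`/Tate-dual exactness
`poitouTate_sha_tateDual`. They are the route's own print binders `PoitouTateSelmerStructureDualityFact` /
`PoitouTateShaTateDualFact` (granted to `closes`), so this stub adds NO debt to the route; it is the only input of the
printed part of the torsion atom below. [cite: MilneADT2006, I Thm. 4.10 and I Thm. 6.13] [cite: Wiles1995, Prop. 1.6] -/
theorem stub_pubPoitouTate :
    (∀ (K : Type) [Field K] [NumberField K], Literature.NumberTheory.GaloisCohomology.poitouTate_selmerStructure_duality K) ∧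
    (∀ (K : Type) [Field K] [NumberField K], Literature.NumberTheory.GaloisCohomology.poitouTate_sha_tateDual K) := by
  sorry

/-- STUB (RESEARCH — the RESIDUE of v5–v7's torsion atom `stub_torsionMult`; v8): under the binders of the child crux (no frame
prime needed) and OFF THE LOCUS «`rank W′(K) = 1 ∧ Ш(W′/K)[3^∞]` finite» — i.e. for 3-multiplicative twins with
`rank W′(K) ≠ 1`, or with `rank W′(K) = 1` and `Ш(W′/K)[3^∞]` infinite — the anticyclotomic BDP Selmer dual
`X^∅_ac(W′/K_∞; slot 𝔭′)` is `Λ`-TORSION. ON the locus this is width seat w2 g3's tree theorem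
`twin_isTorsion_XAc_empty_of_rankOneK_of_poitouTate` (p617974: JSW17 Thm. 3.3.1 / Cas18 Thm. 2.3 control on the constructed
`X_ac`, keyed by JSW's own algebraic inputs, modulo PT1/PT2 only), consumed by `torsionMult_of_stubs`. What remains is the
Heegner side at `3 ∥ N′` in Λ-rank `≥ 1` for the classical Selmer dual (Bertolini 1995 / Howard 2004 Thm. B / Cornut–Vatsal:
`p ∤ N`; Castella 2018 §4, Longo–Vigni: `p ≥ 5`) — NOT in print at a prime of multiplicative reduction dividing the level with
`p = 3`; under the Heegner hypothesis and finiteness of `Ш` the locus left is `rank W′(K)` odd `≥ 3`.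
[cite: JetchevSkinnerWan2017, Thm. 3.3.1 (arXiv:1512.06894 p. 11) (the printed locus)] [cite: Howard2004, Thm. B (the shape off it, p ∤ N)] -/
theorem stub_torsionMultOffRankOne :
    ∀ (W' : WeierstrassCurve ℚ) [W'.IsElliptic] [W'.IsGloballyMinimal] (N' : ℕ) [NeZero N']
      (K : Type) [Field K] [NumberField K],
      Mult W' 3 → W'.HasSurjectiveModNGaloisRep 3 → W'.conductorNorm ℤ = N' → IsImaginaryQuadratic K →
      SatisfiesHeegnerHypothesis N' K → Odd (NumberField.discr K) →
      ((W'.baseChange K).mordellWeilRank = 1 → ¬ Finite (AddCommGroup.primaryComponent (W'.baseChange K).sha 3)) →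
      ∀ (κ : ZpExtension K 3), κ.IsAnticyclotomic → ∀ (γ : absoluteGaloisGroup K) [Fact (κ.IsTopGenerator γ)]
        (𝔭' : HeightOneSpectrum (𝓞 K)), ((3 : ℕ) : 𝓞 K) ∈ 𝔭'.asIdeal →
        Module.IsTorsion (IwasawaAlgebra 3) (AcSelmer.XAc (W'.baseChange K) 3 κ 𝔭' ∅ γ) := by
  sorry

/-- DERIVED (no sorry of its own; = v5–v7's registered `stub_torsionMult` signature VERBATIM; v8): `X^∅_ac(W′/K_∞; slot 𝔭′)`
is `Λ`-torsion for EVERY 3-multiplicative twin under the crux's binders — by cases: ON the locus «`rank W′(K) = 1 ∧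
Ш(W′/K)[3^∞]` finite» it is `twin_isTorsion_XAc_empty_of_rankOneK_of_poitouTate` (p617974) fed the Poitou–Tate facts of
`stub_pubPoitouTate`; OFF it, the research residue `stub_torsionMultOffRankOne`.
[cite: JetchevSkinnerWan2017, Thm. 3.3.1 (arXiv:1512.06894 p. 11)] -/
theorem torsionMult_of_stubs :
    ∀ (W' : WeierstrassCurve ℚ) [W'.IsElliptic] [W'.IsGloballyMinimal] (N' : ℕ) [NeZero N']
      (K : Type) [Field K] [NumberField K],
      Mult W' 3 → W'.HasSurjectiveModNGaloisRep 3 → W'.conductorNorm ℤ = N' → IsImaginaryQuadratic K →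
      SatisfiesHeegnerHypothesis N' K → Odd (NumberField.discr K) →
      ∀ (κ : ZpExtension K 3), κ.IsAnticyclotomic → ∀ (γ : absoluteGaloisGroup K) [Fact (κ.IsTopGenerator γ)]
        (𝔭' : HeightOneSpectrum (𝓞 K)), ((3 : ℕ) : 𝓞 K) ∈ 𝔭'.asIdeal →
        Module.IsTorsion (IwasawaAlgebra 3) (AcSelmer.XAc (W'.baseChange K) 3 κ 𝔭' ∅ γ) := by
  intro W' _ _ N' _ K _ _ hmult hsurj hN' hK hH hodd κ hκ γ _ 𝔭' h𝔭'
  by_cases hloc : (W'.baseChange K).mordellWeilRank = 1 ∧ Finite (AddCommGroup.primaryComponent (W'.baseChange K).sha 3)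
  · -- ON the locus: PRINT (JSW17 3.3.1 control, p617974), modulo the two Poitou–Tate facts
    exact twin_isTorsion_XAc_empty_of_rankOneK_of_poitouTate W' N' K
      stub_pubPoitouTate.1 stub_pubPoitouTate.2 hmult hN' hK hH hloc.1 hloc.2 κ hκ γ 𝔭' h𝔭'
  · -- OFF the locus: the research residue
    exact stub_torsionMultOffRankOne W' N' K hmult hsurj hN' hK hH hodd (fun hr hfin ↦ hloc ⟨hr, hfin⟩) κ hκ γ 𝔭' h𝔭'

/-- DERIVED (no sorry of its own; = v5's registered `stub_sigmaDataMult` signature VERBATIM): the twin's Road-FF `Σ`-data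
at the X-slot — `Σ` finite, `X^Σ_ac` torsion, `P_Σ ≠ 0`, `Ch(X^∅)·(P_Σ) ⊆ Ch(X^Σ)` — from `torsionMult_of_stubs` ALONE by
`twin_sigmaDataAt_of_isTorsion_empty'` (p613967 = the LEAD's p611180 §3 with its two published binders DISCHARGED:
Shapiro [SU14 3.2.3] `prop323_XAc_equiv_XBigDecomp_holds`, the local `Σ`-display [JSW17 pf. of 6.1.6]
`sigmaLocal_charIdeal_eulerFactor_mem_of_noTamagawaDefect_proved`; no Tamagawa defect under the all-split Heegner field).
[cite: JetchevSkinnerWan2017, §5.1 and proof of Thm. 6.1.6] [cite: SkinnerUrban2014, Prop. 3.2.3] [cite: Castella2018, Prop. 2.5] -/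
theorem sigmaDataMult_of_stubs :
    ∀ (W' : WeierstrassCurve ℚ) [W'.IsElliptic] [W'.IsGloballyMinimal] (N' : ℕ) [NeZero N']
      (K : Type) [Field K] [NumberField K],
      Mult W' 3 → W'.HasSurjectiveModNGaloisRep 3 → W'.conductorNorm ℤ = N' → IsImaginaryQuadratic K →
      SatisfiesHeegnerHypothesis N' K → Odd (NumberField.discr K) →
      ∀ (κ : ZpExtension K 3), κ.IsAnticyclotomic → ∀ (γ : absoluteGaloisGroup K) [Fact (κ.IsTopGenerator γ)]
        (𝔭' : HeightOneSpectrum (𝓞 K)), ((3 : ℕ) : 𝓞 K) ∈ 𝔭'.asIdeal →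
        P2.RoadFF.SigmaDataAt W' 3 κ 𝔭' γ (↑(W'.sigmaPlacesFinset 3 K) : Set (HeightOneSpectrum (𝓞 K)))
          (W'.sigmaEulerElement 3 K κ) := by
  intro W' _ _ N' _ K _ _ hmult hsurj hN' hK hH hodd κ hκ γ _ 𝔭' h𝔭'
  exact twin_sigmaDataAt_of_isTorsion_empty' W' N' K hmult hN' hK hH κ hκ γ 𝔭' h𝔭'
    (torsionMult_of_stubs W' N' K hmult hsurj hN' hK hH hodd κ hκ γ 𝔭' h𝔭')

/-- STUB (BY-NAME, PUBLISHED — closes only by formalisation; v8 = K3 of the member-tower card): Skinner 2016 §3.1 (a)(b) =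
§2.6 (2-6-1) at the PRINTED generality `p ≥ 3` — for a globally minimal elliptic `W/ℚ`, a prime `p ≥ 3` of multiplicative
reduction with `E[p]` irreducible and every `m ≥ 1`, a Hida member at level `m` exists (`Nonempty (HidaCongruentMember W p m)`:
a `p`-ordinary newform `g_m ∈ S_{k_m}(Γ₀(N/p))`, `k_m > 2`, `k_m ≡ 2 (mod p − 1)`, congruent to `f_E` mod `p^m`, with
`A_{g_m}[p^m] ≅ (E[p^∞] ⊗ 𝒪_m)[p^m]` `G_ℚ`-equivariantly). Typed by utd-ty1 g3 (p614192, review lane, landed 07:54Z) as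
`skinner2016_exists_hidaCongruentMember_three_le`; its `p = 3` instance `skinner2016_exists_hidaCongruentMember_three` feeds
`memberTowerMult_of_stubs`. Reading flag `F2-p-ge-3` of that file (which published proof of Hida's control theorem covers
`p = 3`: EPW Thm. 2.1.2) is informational. [cite: Skinner2016PacificMC, §2 (p. 5, "p odd"), Thm. A (p. 3, "p ≥ 3"), §2.6 (2-6-1) and §3.1 (a)(b) (p. 192)]
[cite: EmertonPollackWeston2006, Thm. 2.1.2] -/
theorem stub_pubHidaMembers : Skinner2016.skinner2016_exists_hidaCongruentMember_three_le := by
  sorry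

/-- STUB (THE RESEARCH LOAD OF THE LINE, v8 — the per-member content of v7's `stub_memberTowerMult` with the members'
EXISTENCE removed (now `stub_pubHidaMembers`, print)). Under the binders of the child crux: a frame `(Ω_K ≠ 0, Ω_p ≠ 0, L)` of
`f_{W′}` at `(ι′, 𝔭)` (ANY non-zero `Ω_p ∈ ℂ₃`) and ONE exponent `e` such that FOR EVERY level `m ≥ 1` and EVERY Hida member
`D = (k_m, g_m, ι_m, Δ_m, e_m)` of `f_{W′}` at level `m` (good-ordinary newform of weight `k_m > 2` and level `N′/3`,
congruent to `f_{W′}` mod `3^m`), in every receptacle `S₀` over `R₀` and `𝒪_m`, there is `L_m ∈ S₀⟦T⟧` with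
(K1) the RATIONAL one-sided inclusion «`X^Σ_ac(A_{g_m}/K_∞; slot 𝔭′)` torsion → `(3^e)·Ch(X^Σ_ac(A_{g_m}))·S₀⟦T⟧ ⊆ (L_m)`»
[a weight-`k_m` anticyclotomic Eisenstein/Greenberg-side inclusion for a GOOD-ORDINARY member under the ALL-SPLIT `K`, with
an exponent UNIFORM in the member — engine in print only in weight 2: Yan–Zhu 2026 Thm. 4.4 = [SU14, Thm. 7.7 + Prop. 13.6 (1)]
(family level, `S ⊂ Λ_K⁺`-localised, `p > 2`, Rem. 4.5 «no hypotheses on N») → Thm. 4.7 (Beilinson–Flach transfer ord → Gr)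
→ Thm. 5.7 (1) (anticyclotomic restriction); m-uniformity (K1b) = no vertical component of `𝓛^Σ_{𝐟′,K}` through the 3-new
point — unprinted] and (K2) the congruence «`(L_m) ⊆ (L·P_Σ) + (3^m)`» [`L_m` is tied to `L` only here: the `Σ`-imprimitive
BDP functions of `g_m` and `f_{W′}` are the weight-`k_m` and weight-2 specialisations of ONE two-variable function of the Hida
family of tame level `N′/3` — Castella 2020 (JIMJ 19) Thm. 2.11, `p ∤ 6N`-free form `p > 2`; at the 3-new weight-2 point the
specialisation is [ibid. §2.6 / Castella 2018 Thm. 3.1's `p ∣ N` clause]]. Quantifying over ALL members (not one per `m`) is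
harmless for (K1) (a statement about every good-ordinary newform of level `N′/3`) and for (K2) (every member is a point of
the same family). Consumed, with `stub_pubHidaMembers`, by `memberTowerMult_of_stubs`; WEAKER per member than the integral
tower of v4–v6. [cite: Skinner2016PacificMC, §3.1 (c) and (2.5)_m (p. 192) (the shape)] [cite: Castella2020JIMJ, §2.5–2.6, Thm. 2.11]
[cite: YanZhu2026, Thm. 4.4, Rem. 4.5, Cor. 4.6, Thm. 4.7, Thm. 5.7 (1) (arXiv:2412.20078 pp. 10–13)] [cite: Castella2018Erratum, proof of Thm. 1.1, (c) and (2.5)_m (p. 4)] -/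
theorem stub_memberInclusionMult :
    ∀ (W' : WeierstrassCurve ℚ) [W'.IsElliptic] [W'.IsGloballyMinimal] (N' : ℕ) [NeZero N']
      (K : Type) [Field K] [NumberField K] (Dt' : ModularParametrizationData W' N'),
      Mult W' 3 → W'.HasSurjectiveModNGaloisRep 3 → W'.conductorNorm ℤ = N' → IsImaginaryQuadratic K →
      SatisfiesHeegnerHypothesis N' K → Odd (NumberField.discr K) →
      ∀ (κ : ZpExtension K 3), κ.IsAnticyclotomic → ∀ (γ : absoluteGaloisGroup K) [Fact (κ.IsTopGenerator γ)]
        (𝔭 : HeightOneSpectrum (𝓞 K)), ((3 : ℕ) : 𝓞 K) ∈ 𝔭.asIdeal →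
        𝔭.asIdeal.ramificationIdx (𝓞 ℚ) = 1 → 𝔭.asIdeal.inertiaDeg (𝓞 ℚ) = 1 →
        ∀ (𝔭' : HeightOneSpectrum (𝓞 K)), ((3 : ℕ) : 𝓞 K) ∈ 𝔭'.asIdeal → 𝔭' ≠ 𝔭 →
        ∀ (ι' : PadicAlgCl 3 ≃+* ℂ), BranchInducesPrime 3 ι' 𝔭 →
        ∃ (ΩK : ℂ) (Ωp : ℂ_[3]) (L : UnrSeries 3),
          ΩK ≠ 0 ∧ Ωp ≠ 0 ∧ IsBDPLFunction ι' 𝔭 κ γ Dt'.f ΩK Ωp L ∧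
          ∃ e : ℕ, ∀ m : ℕ, 1 ≤ m →
            ∀ D : Skinner2016.HidaCongruentMember W' 3 m,
              ∀ [TopologicalSpace (PowerSeries (padicCoeffIntegers D.ι))]
                [ContinuousSMul (PowerSeries (padicCoeffIntegers D.ι))
                  (BigRepModule (padicCoeffIntegers D.ι) 3 (Cofree D.Δ.ρ (padicCoeffField D.ι)))],
              ∀ (S₀ : Type) [CommRing S₀] (a : unrIntegers 3 →+* S₀) (b : padicCoeffIntegers D.ι →+* S₀)
                (j : ℤ_[3] →+* unrIntegers 3),
                (∀ x : ℤ_[3], ((j x : unrIntegers 3) : ℂ_[3]) = algebraMap ℚ_[3] ℂ_[3] (x : ℚ_[3])) →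
                a.comp j = b.comp (algebraMap ℤ_[3] (padicCoeffIntegers D.ι)) →
                ∃ Lm : PowerSeries S₀,
                  (Module.IsTorsion (PowerSeries (padicCoeffIntegers D.ι))
                      (XBig κ (D.Δ.cofreeRepOver K) 𝔭' (↑(W'.sigmaPlacesFinset 3 K))) →
                    Ideal.span {((3 : ℕ) : PowerSeries S₀) ^ e} *
                        (XBig.charIdeal κ (D.Δ.cofreeRepOver K) 𝔭' (↑(W'.sigmaPlacesFinset 3 K))).map
                          (PowerSeries.map b) ≤ Ideal.span {Lm}) ∧
                  Ideal.span {Lm} ≤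
                    Ideal.span {PowerSeries.map a (L * PowerSeries.map j (W'.sigmaEulerElement 3 K κ))} ⊔
                      Ideal.span {((3 : ℕ) : PowerSeries S₀) ^ m} := by
  sorry

/-- DERIVED (no sorry of its own; = v7's registered `stub_memberTowerMult` signature VERBATIM; v8): the RATIONAL, `m`-UNIFORM
Hida member tower at the 3-multiplicative twin — frame, ONE exponent `e`, and for every `m ≥ 1` SOME member with (K1) ∧ (K2)
— from `stub_pubHidaMembers` (the member at level `m` exists: `Mult W′ 3` is multiplicative reduction at `3`, and `ρ̄₃` onto
⟹ `E[3]` irreducible, `hasIrreducibleModPGaloisRep_of_hasSurjectiveModNGaloisRep`) and `stub_memberInclusionMult` (the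
inclusions hold for every member). Consumed by `twin_exists_wanFrame_of_sigmaData_of_rationalMemberTower` (p616714) with `k = e`.
[cite: Skinner2016PacificMC, §2.6 (2-6-1), §3.1 (a)(b)(c) (p. 192)] [cite: Castella2018Erratum, proof of Thm. 1.1 (p. 4)] -/
theorem memberTowerMult_of_stubs :
    ∀ (W' : WeierstrassCurve ℚ) [W'.IsElliptic] [W'.IsGloballyMinimal] (N' : ℕ) [NeZero N']
      (K : Type) [Field K] [NumberField K] (Dt' : ModularParametrizationData W' N'),
      Mult W' 3 → W'.HasSurjectiveModNGaloisRep 3 → W'.conductorNorm ℤ = N' → IsImaginaryQuadratic K →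
      SatisfiesHeegnerHypothesis N' K → Odd (NumberField.discr K) →
      ∀ (κ : ZpExtension K 3), κ.IsAnticyclotomic → ∀ (γ : absoluteGaloisGroup K) [Fact (κ.IsTopGenerator γ)]
        (𝔭 : HeightOneSpectrum (𝓞 K)), ((3 : ℕ) : 𝓞 K) ∈ 𝔭.asIdeal →
        𝔭.asIdeal.ramificationIdx (𝓞 ℚ) = 1 → 𝔭.asIdeal.inertiaDeg (𝓞 ℚ) = 1 →
        ∀ (𝔭' : HeightOneSpectrum (𝓞 K)), ((3 : ℕ) : 𝓞 K) ∈ 𝔭'.asIdeal → 𝔭' ≠ 𝔭 →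
        ∀ (ι' : PadicAlgCl 3 ≃+* ℂ), BranchInducesPrime 3 ι' 𝔭 →
        ∃ (ΩK : ℂ) (Ωp : ℂ_[3]) (L : UnrSeries 3),
          ΩK ≠ 0 ∧ Ωp ≠ 0 ∧ IsBDPLFunction ι' 𝔭 κ γ Dt'.f ΩK Ωp L ∧
          ∃ e : ℕ, ∀ m : ℕ, 1 ≤ m →
            ∃ D : Skinner2016.HidaCongruentMember W' 3 m,
              ∀ [TopologicalSpace (PowerSeries (padicCoeffIntegers D.ι))]
                [ContinuousSMul (PowerSeries (padicCoeffIntegers D.ι))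
                  (BigRepModule (padicCoeffIntegers D.ι) 3 (Cofree D.Δ.ρ (padicCoeffField D.ι)))],
              ∀ (S₀ : Type) [CommRing S₀] (a : unrIntegers 3 →+* S₀) (b : padicCoeffIntegers D.ι →+* S₀)
                (j : ℤ_[3] →+* unrIntegers 3),
                (∀ x : ℤ_[3], ((j x : unrIntegers 3) : ℂ_[3]) = algebraMap ℚ_[3] ℂ_[3] (x : ℚ_[3])) →
                a.comp j = b.comp (algebraMap ℤ_[3] (padicCoeffIntegers D.ι)) →
                ∃ Lm : PowerSeries S₀,
                  (Module.IsTorsion (PowerSeries (padicCoeffIntegers D.ι))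
                      (XBig κ (D.Δ.cofreeRepOver K) 𝔭' (↑(W'.sigmaPlacesFinset 3 K))) →
                    Ideal.span {((3 : ℕ) : PowerSeries S₀) ^ e} *
                        (XBig.charIdeal κ (D.Δ.cofreeRepOver K) 𝔭' (↑(W'.sigmaPlacesFinset 3 K))).map
                          (PowerSeries.map b) ≤ Ideal.span {Lm}) ∧
                  Ideal.span {Lm} ≤
                    Ideal.span {PowerSeries.map a (L * PowerSeries.map j (W'.sigmaEulerElement 3 K κ))} ⊔
                      Ideal.span {((3 : ℕ) : PowerSeries S₀) ^ m} := by
  intro W' _ _ N' _ K _ _ Dt' hmult hsurj hN' hK hH hodd κ hκ γ _ 𝔭 h𝔭 he hf 𝔭' h𝔭' hne ι' hι'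
  have h := stub_memberInclusionMult W' N' K Dt' hmult hsurj hN' hK hH hodd κ hκ γ 𝔭 h𝔭 he hf 𝔭' h𝔭' hne ι' hι'
  rcases h with ⟨ΩK, Ωp, L, hΩK, hΩp, hL, e, hmem⟩
  have hirr : W'.HasIrreducibleModPGaloisRep 3 :=
    hasIrreducibleModPGaloisRep_of_hasSurjectiveModNGaloisRep W' 3 hsurj
  -- term mode on purpose: `obtain ⟨D⟩ := …` in this goal hits the whnf heartbeat ceiling (rcases reverts the goal)
  exact ⟨ΩK, Ωp, L, hΩK, hΩp, hL, e, fun m hm ↦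
    (Skinner2016.skinner2016_exists_hidaCongruentMember_three stub_pubHidaMembers W' hmult hirr m hm).elim
      fun D ↦ ⟨D, @hmem m hm D⟩⟩

/-- STUB (THE CUBE LOCUS — research): the rational Wan frame (♭B's consequent VERBATIM) RESTRICTED to twins `W′` with a
Tate parameter datum `D` at 3 (so `W′` is SPLIT multiplicative at 3) whose `q` is a CUBE in `ℚ₃` — the EXACT locus where the
descent kernel's local binder (dec) `W′(ℚ₃)[3] = 0` FAILS (`twin_not_dec_of_cube`, p612881: Tate uniformisation V.3.1/V.5.3,
all tree theorems), strictly inside v5's «split ∧ 3 ∣ v₃(Δ_min)» (`split_and_dvd_of_cube`) and decidable as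
«3 ∣ v₃(Δ_min(W′)) ∧ q·3^{−v₃(q)} ≡ ±1 (mod 9)» (`twin_cube_locus_iff`, `three_mul_eq_valuation_of_eq`, p614724; census D7″).
There the member congruence `e_m` (p609362) is unavailable as typed (the strict condition induced on `W′[3^m]` at `𝔭'` is
`W′(K_{𝔭'})[3^∞]/3^m ≠ 0`); a bounded-defect descent (error `#W′(ℚ₃)[3^∞]`, m-uniform, absorbed by `k`) is the natural
attack and is not in the tree. [cite: SilvermanATAEC1994, Thm. V.3.1 (d) and Thm. V.5.3 (the locus)]
[cite: Castella2018Erratum, Thm. A′ (2) and Remark (p. 2) («condition (b) of [SZ14]»)] -/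
theorem stub_wanFrameMultCube :
    ∀ (W' : WeierstrassCurve ℚ) [W'.IsElliptic] [W'.IsGloballyMinimal] (N' : ℕ) [NeZero N']
      (K : Type) [Field K] [NumberField K] (Dt' : ModularParametrizationData W' N'),
      Mult W' 3 → W'.HasSurjectiveModNGaloisRep 3 → W'.conductorNorm ℤ = N' → IsImaginaryQuadratic K →
      SatisfiesHeegnerHypothesis N' K → Odd (NumberField.discr K) →
      ∀ (κ : ZpExtension K 3), κ.IsAnticyclotomic → ∀ (γ : absoluteGaloisGroup K) [Fact (κ.IsTopGenerator γ)]
        (𝔭 : HeightOneSpectrum (𝓞 K)), ((3 : ℕ) : 𝓞 K) ∈ 𝔭.asIdeal →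
        𝔭.asIdeal.ramificationIdx (𝓞 ℚ) = 1 → 𝔭.asIdeal.inertiaDeg (𝓞 ℚ) = 1 →
        ∀ (𝔭' : HeightOneSpectrum (𝓞 K)), ((3 : ℕ) : 𝓞 K) ∈ 𝔭'.asIdeal → 𝔭' ≠ 𝔭 →
        ∀ (ι' : PadicAlgCl 3 ≃+* ℂ), BranchInducesPrime 3 ι' 𝔭 →
        ∀ (D : WeierstrassCurve.TateParameterData W' 3) (u : ℚ_[3]), u ^ 3 = D.q →
        ∃ (ΩK : ℂ) (Ωp : ℂ_[3]) (L : UnrSeries 3), ΩK ≠ 0 ∧ Ωp ≠ 0 ∧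
          IsBDPLFunction ι' 𝔭 κ γ Dt'.f ΩK Ωp L ∧
          ∃ k : ℕ, ∀ G ∈ (AcSelmer.XAc.charIdeal (W'.baseChange K) 3 κ 𝔭' ∅ γ).map
            (PowerSeries.map (toUnr 3)), PowerSeries.C (((3 : ℕ) : unrIntegers 3) ^ k) * G ∈ Ideal.span {L} := by
  sorry

/-- DERIVED (no sorry of its own; = v3's registered `stub_wanFrameMult` signature = ♭B VERBATIM): the rational Wan frame at
a multiplicative-at-3 twin, by the EXACT dichotomy `twin_dec_or_cube` (p612881): EITHER (dec) `W′(ℚ₃)[3] = 0` holds — then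
the RATIONAL m-uniform member tower (DERIVED `memberTowerMult_of_stubs`: members by name + `stub_memberInclusionMult`) runs
through the landed descent kernel `twin_exists_wanFrame_of_sigmaData_of_rationalMemberTower` (p616714: `e_m` at p = 3,
`3^e`-twisted Fitting-level descent and recombination p612782, `k = e`) with Shapiro a THEOREM
(`prop323_XAc_equiv_XBigDecomp_holds`) and the `Σ`-data DERIVED from `torsionMult_of_stubs` (`sigmaDataMult_of_stubs`) — OR a
Tate datum with cube `q` exists, and `stub_wanFrameMultCube` answers.
[cite: Skinner2016PacificMC, §3.1 (p. 192) (mechanism)] [cite: Castella2018Erratum, proof of Thm. 1.1 (p. 4) (shape)]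
[cite: SilvermanATAEC1994, Thm. V.3.1 (d) and Thm. V.5.3 (the dichotomy)] -/
theorem wanFrameMult_of_stubs :
    ∀ (W' : WeierstrassCurve ℚ) [W'.IsElliptic] [W'.IsGloballyMinimal] (N' : ℕ) [NeZero N']
      (K : Type) [Field K] [NumberField K] (Dt' : ModularParametrizationData W' N'),
      Mult W' 3 → W'.HasSurjectiveModNGaloisRep 3 → W'.conductorNorm ℤ = N' → IsImaginaryQuadratic K →
      SatisfiesHeegnerHypothesis N' K → Odd (NumberField.discr K) →
      ∀ (κ : ZpExtension K 3), κ.IsAnticyclotomic → ∀ (γ : absoluteGaloisGroup K) [Fact (κ.IsTopGenerator γ)]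
        (𝔭 : HeightOneSpectrum (𝓞 K)), ((3 : ℕ) : 𝓞 K) ∈ 𝔭.asIdeal →
        𝔭.asIdeal.ramificationIdx (𝓞 ℚ) = 1 → 𝔭.asIdeal.inertiaDeg (𝓞 ℚ) = 1 →
        ∀ (𝔭' : HeightOneSpectrum (𝓞 K)), ((3 : ℕ) : 𝓞 K) ∈ 𝔭'.asIdeal → 𝔭' ≠ 𝔭 →
        ∀ (ι' : PadicAlgCl 3 ≃+* ℂ), BranchInducesPrime 3 ι' 𝔭 →
        ∃ (ΩK : ℂ) (Ωp : ℂ_[3]) (L : UnrSeries 3), ΩK ≠ 0 ∧ Ωp ≠ 0 ∧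
          IsBDPLFunction ι' 𝔭 κ γ Dt'.f ΩK Ωp L ∧
          ∃ k : ℕ, ∀ G ∈ (AcSelmer.XAc.charIdeal (W'.baseChange K) 3 κ 𝔭' ∅ γ).map
            (PowerSeries.map (toUnr 3)), PowerSeries.C (((3 : ℕ) : unrIntegers 3) ^ k) * G ∈ Ideal.span {L} := by
  intro W' _ _ N' _ K _ _ Dt' hmult hsurj hN' hK hH hodd κ hκ γ _ 𝔭 h𝔭 he hf 𝔭' h𝔭' hne ι' hι'
  rcases twin_dec_or_cube W' hmult with hdec | ⟨D, u, hu⟩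
  · -- (dec) holds: run the member tower through the descent kernel (Shapiro and the Σ-data are theorems now)
    obtain ⟨ΩK, Ωp, L, hΩ, hΩp, hL, e, hmem⟩ :=
      memberTowerMult_of_stubs W' N' K Dt' hmult hsurj hN' hK hH hodd κ hκ γ 𝔭 h𝔭 he hf 𝔭' h𝔭' hne ι' hι'
    exact twin_exists_wanFrame_of_sigmaData_of_rationalMemberTower SkinnerUrban2014.prop323_XAc_equiv_XBigDecomp_holds
      W' N' K hmult hsurj hN' hK hH κ hκ γ 𝔭 𝔭' h𝔭' ι' Dt'.f hdec
      (sigmaDataMult_of_stubs W' N' K hmult hsurj hN' hK hH hodd κ hκ γ 𝔭' h𝔭') hΩ hΩp hL e hmem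
  · -- the cube locus: (dec) is false there (`twin_not_dec_of_cube`); the residual research stub answers
    exact stub_wanFrameMultCube W' N' K Dt' hmult hsurj hN' hK hH hodd κ hκ γ 𝔭 h𝔭 he hf 𝔭' h𝔭' hne ι' hι' D u hu

/-- DERIVED, OFF THE CUBE STUB (lead g12): ♭B's consequent for a 3-multiplicative twin with `3 ∤ v₃(Δ_min(W′))` — in
particular for every twin whose mod-3 representation is TRÈS RAMIFIÉ at 3, i.e. for EVERY twin of a bucket-B class
(helper `UniversalToricDescentTwinCubeLocusTresRamifie`, p621446: Serre 1987 §2.9 Prop. 5 ⟹ très ramifié forces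
`3 ∤ v₃(Δ_min)`; `O6.ModPCongruent` transports très ramifié from the class to the twin) — from the member tower ALONE:
(dec) holds by w2's `forall_not_exists_pow_of_nonsplit_or_not_dvd` + `twin_dec_of_forall_not_cube` (p612881), so
`stub_wanFrameMultCube` is NOT consumed. This is the closing theorem of the candidate re-keyed crux «♭B with the extra
binder `¬ 3 ∣ v₃(Δ_min(W′))`» (turnkey to the UTD pen; the kernel's Mult branch discharges the binder on très ramifié
classes and routes peu ramifié classes to a good-ordinary twin supply).
[cite: Serre1987, §2.9 Prop. 5] [cite: MazurTateTeitelbaum1986Invent, §II.1] [cite: Skinner2016PacificMC, §3.1 (p. 192) (mechanism)] -/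
theorem wanFrameMult_of_stubs_of_not_dvd :
    ∀ (W' : WeierstrassCurve ℚ) [W'.IsElliptic] [W'.IsGloballyMinimal] (N' : ℕ) [NeZero N']
      (K : Type) [Field K] [NumberField K] (Dt' : ModularParametrizationData W' N'),
      Mult W' 3 → W'.HasSurjectiveModNGaloisRep 3 → W'.conductorNorm ℤ = N' → IsImaginaryQuadratic K →
      SatisfiesHeegnerHypothesis N' K → Odd (NumberField.discr K) →
      ¬ 3 ∣ padicValInt 3 W'.minimalDiscriminantInt →
      ∀ (κ : ZpExtension K 3), κ.IsAnticyclotomic → ∀ (γ : absoluteGaloisGroup K) [Fact (κ.IsTopGenerator γ)]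
        (𝔭 : HeightOneSpectrum (𝓞 K)), ((3 : ℕ) : 𝓞 K) ∈ 𝔭.asIdeal →
        𝔭.asIdeal.ramificationIdx (𝓞 ℚ) = 1 → 𝔭.asIdeal.inertiaDeg (𝓞 ℚ) = 1 →
        ∀ (𝔭' : HeightOneSpectrum (𝓞 K)), ((3 : ℕ) : 𝓞 K) ∈ 𝔭'.asIdeal → 𝔭' ≠ 𝔭 →
        ∀ (ι' : PadicAlgCl 3 ≃+* ℂ), BranchInducesPrime 3 ι' 𝔭 →
        ∃ (ΩK : ℂ) (Ωp : ℂ_[3]) (L : UnrSeries 3), ΩK ≠ 0 ∧ Ωp ≠ 0 ∧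
          IsBDPLFunction ι' 𝔭 κ γ Dt'.f ΩK Ωp L ∧
          ∃ k : ℕ, ∀ G ∈ (AcSelmer.XAc.charIdeal (W'.baseChange K) 3 κ 𝔭' ∅ γ).map
            (PowerSeries.map (toUnr 3)), PowerSeries.C (((3 : ℕ) : unrIntegers 3) ^ k) * G ∈ Ideal.span {L} := by
  intro W' _ _ N' _ K _ _ Dt' hmult hsurj hN' hK hH hodd hndvd κ hκ γ _ 𝔭 h𝔭 he hf 𝔭' h𝔭' hne ι' hι'
  have hdec : ∀ Q : (W'.baseChange ℚ_[3]).toAffine.Point, 3 • Q = 0 → Q = 0 :=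
    twin_dec_of_forall_not_cube W' hmult (forall_not_exists_pow_of_nonsplit_or_not_dvd W' (Or.inr hndvd))
  have h := memberTowerMult_of_stubs W' N' K Dt' hmult hsurj hN' hK hH hodd κ hκ γ 𝔭 h𝔭 he hf 𝔭' h𝔭' hne ι' hι'
  rcases h with ⟨ΩK, Ωp, L, hΩ, hΩp, hL, e, hmem⟩
  exact twin_exists_wanFrame_of_sigmaData_of_rationalMemberTower SkinnerUrban2014.prop323_XAc_equiv_XBigDecomp_holds
    W' N' K hmult hsurj hN' hK hH κ hκ γ 𝔭 𝔭' h𝔭' ι' Dt'.f hdec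
    (sigmaDataMult_of_stubs W' N' K hmult hsurj hN' hK hH hodd κ hκ γ 𝔭' h𝔭') hΩ hΩp hL e hmem

/-- DERIVED (no sorry of its own): every `R₀`-frame of `f_W` has a UNIT coefficient, at ANY reduction type at `3`, from
`stub_thmB` — utd-p1 g4's ♭-witness `self_exists_isBDPLFunctionInt_coeff_norm_eq_one` moved across periods and
receptacles by `exists_coeff_norm_eq_one_of_isBDPLFunctionInt_of_isBDPLFunction` (p538896), read through
`unrIntegers.isUnit_iff_norm_eq_one`. UNCHANGED from v3. [cite: Hsieh2014, Thm. B p. 712 (Doc. Math. 19)] -/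
theorem exists_isUnit_coeff_of_frame
    (W : WeierstrassCurve ℚ) [W.IsElliptic] (N : ℕ) [NeZero N]
    (K : Type) [Field K] [NumberField K] (Dt : ModularParametrizationData W N)
    (honto : W.HasSurjectiveModNGaloisRep 3) (hK : IsImaginaryQuadratic K)
    (hH : SatisfiesHeegnerHypothesis N K) (κ : ZpExtension K 3) (hκ : κ.IsAnticyclotomic)
    (γ : absoluteGaloisGroup K) [Fact (κ.IsTopGenerator γ)]
    (𝔭 : HeightOneSpectrum (𝓞 K)) (h𝔭 : ((3 : ℕ) : 𝓞 K) ∈ 𝔭.asIdeal)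
    (he : 𝔭.asIdeal.ramificationIdx (𝓞 ℚ) = 1) (hf : 𝔭.asIdeal.inertiaDeg (𝓞 ℚ) = 1)
    (ι' : PadicAlgCl 3 ≃+* ℂ) (hι' : BranchInducesPrime 3 ι' 𝔭)
    {ΩK : ℂ} {Ωp : ℂ_[3]} {L : UnrSeries 3} (hΩK : ΩK ≠ 0) (hΩp : Ωp ≠ 0)
    (hL : IsBDPLFunction ι' 𝔭 κ γ Dt.f ΩK Ωp L) :
    ∃ i : ℕ, IsUnit (PowerSeries.coeff i L) := by
  obtain ⟨ΩK₁, Ωp₁, Q, hΩK₁, hΩp₁, hQ, hμQ⟩ :=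
    Summit.BirchSwinnertonDyer.BirchSwinnertonDyer.Theorems.UniversalToricDescentSelfMuZero.self_exists_isBDPLFunctionInt_coeff_norm_eq_one stub_thmB W N K Dt honto hK hH
      κ hκ γ 𝔭 h𝔭 he hf ι' hι'
  have hΩp₁0 : Ωp₁ ≠ 0 := fun h ↦ by rw [h, norm_zero] at hΩp₁; exact zero_ne_one hΩp₁
  obtain ⟨i, hi⟩ :=
    Summit.BirchSwinnertonDyer.BirchSwinnertonDyer.Theorems.UniversalToricDescentFlatMuTransfer.exists_coeff_norm_eq_one_of_isBDPLFunctionInt_of_isBDPLFunction hK hκ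
      Fact.out hΩK₁ hΩK hΩp₁0 hΩp hQ hL hμQ
  exact ⟨i, (unrIntegers.isUnit_iff_norm_eq_one _).mpr hi⟩

/-- COMPOSITION (unchanged idea): the Howard frame stub, the DERIVED Wan frame and the by-name facts give the child
crux BY NAME (`twinSplit_instance_of_three_frames`, p543791; the `μ`-frame is the Howard frame, unit coefficient by
`exists_isUnit_coeff_of_frame`). -/
theorem TwinSplitIMCAtThreeMult_of :
    Summit.BirchSwinnertonDyer.BirchSwinnertonDyer.Theses.UniversalToricDescent.TwinSplitIMCAtThreeMult := by
  intro W' _ _ N' _ K _ _ Dt' hmult hsurj hN' hK hH hodd κ hκ γ _ 𝔭 h𝔭 he hf 𝔭' h𝔭' hne ι' hι'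
  have hH1 := stub_howardFrameMult W' N' K Dt' hmult hsurj hN' hK hH hodd κ hκ γ 𝔭 h𝔭 he hf 𝔭' h𝔭' hne ι' hι'
  have hMu : ∃ (ΩK : ℂ) (Ωp : ℂ_[3]) (L : UnrSeries 3), ΩK ≠ 0 ∧ Ωp ≠ 0 ∧
      IsBDPLFunction ι' 𝔭 κ γ Dt'.f ΩK Ωp L ∧ ∃ i : ℕ, IsUnit (PowerSeries.coeff i L) := by
    obtain ⟨ΩK, Ωp, L, hΩK, hΩp, hL, -⟩ := hH1
    exact ⟨ΩK, Ωp, L, hΩK, hΩp, hL, exists_isUnit_coeff_of_frame W' N' K Dt' hsurj hK hH κ hκ γ 𝔭 h𝔭 he hf ι' hι'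
      hΩK hΩp hL⟩
  exact twinSplit_instance_of_three_frames W' N' K Dt' κ γ 𝔭 𝔭' ι' hK hκ hH1
    (wanFrameMult_of_stubs W' N' K Dt' hmult hsurj hN' hK hH hodd κ hκ γ 𝔭 h𝔭 he hf 𝔭' h𝔭' hne ι' hι') hMu

end Summit.BirchSwinnertonDyer.BirchSwinnertonDyer.Cruxes.TwinSplitIMCAtThreeMult.ThreeFrames

end
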